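import Mathlib
import HarnessLib
import Summits.NavierStokesRegularity.NavierStokesRegularity.Theorems.TaylorModelRungThreeCertificateFormatVGrowth
import Summits.NavierStokesRegularity.NavierStokesRegularity.Theorems.TaylorModelRungThreeReadoutVGrowthBridge
import Summits.NavierStokesRegularity.NavierStokesRegularity.Theorems.TaylorModelRungThreeCertificateFormatVCoreSound

/-!
# Crux K1b-DR (stmt-NavierStokesRegularity-23954), line `taylor-model` — v3 growth checker, SOUNDNESS part 1:
# the chunk run certifies the TRUE products (tm-g4 g4)

For the definitions of `…FormatVGrowth` (`GCtx`, `prodM`, `gD`, `growthRun/growthRange`, `checkL1/checkR0/checkR1`):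
generic helpers (`maxUpTo`, `leMatD`, `magM` entries, the identity interval matrix, `Array.getD` after `map/push/ofFn`);
`GCtx.rowsum_le_facOf` / `CertTablesV.rowsum_le_facOf` (`Σ_t mag(P_{r,t})·w_t ≤ facOf P w · ω_j(wk r)`); `pre_invariant`,
**`growthRun_sound`**, **`growthRange_sound`** — ONE forward replay from the true node state certifies, for every sub-step of the
chunk, the chain Boolean, the caller's predicate, `0 ≤ L1_s ≤ gL1[s]`, and the pair tests of all pairs `(a', s+1)` with the
factors of the TRUE interval products `prodM` (run invariant `pre[i] = prodM (qL+i) (s − qL − i)`), plus the emitted claims at the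
chunk end (**`claims_sound`**: `|prodM (qL) L| ≤ T̃_q`, `(|prodM a (C−a)|·ω↑)↑ ≤ ũ_a`). Parts 2/3: `…FormatVGrowthPairs` ((R3)),
`…FormatVGrowthSound` ((R2), (R0), (R1), assembly). MODEL-lattice bookkeeping only (rung TL-M3); nothing here is a statement about
the Navier–Stokes equations.
-/

-- the sub-problem namespace repeats the summit name by design (D-0017)
set_option linter.dupNamespace false

namespace Summit.NavierStokesRegularity.NavierStokesRegularity.Theorems.TaylorModelCert

open scoped BigOperators

open Literature.Analysis.FluidPDE.TaoCascade Literature.Analysis.FluidPDE.TaoCascade.TaylorChain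
open Summit.NavierStokesRegularity.NavierStokesRegularity.Theorems.TaylorModelReadout
open Summit.NavierStokesRegularity.NavierStokesRegularity.Theorems.TaylorModelV

/-! ### Generic helpers -/

/-- [folklore] -/
theorem le_maxUpTo (v : ℕ → Dyad) : ∀ {k r : ℕ}, r < k → (v r).toReal ≤ (maxUpTo v k).toReal
  | 0, _, h => absurd h (Nat.not_lt_zero _)
  | k + 1, r, h => by
    rw [maxUpTo, Dyad.toReal_max]
    rcases Nat.lt_succ_iff_lt_or_eq.1 h with h' | h'
    · exact (le_maxUpTo v h').trans (le_max_left _ _)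
    · subst h'; exact le_max_right _ _

/-- [folklore] -/
theorem maxUpTo_nonneg (v : ℕ → Dyad) : ∀ k : ℕ, 0 ≤ (maxUpTo v k).toReal
  | 0 => by simp [maxUpTo, Dyad.toReal_zero]
  | k + 1 => by rw [maxUpTo, Dyad.toReal_max]; exact (maxUpTo_nonneg v k).trans (le_max_left _ _)

/-- [folklore] -/
theorem le_of_leMatD {n : ℕ} {A B : Array (Array Dyad)} (h : leMatD n A B = true) {r c : ℕ} (hr : r < n) (hc : c < n) :
    dre A r c ≤ dre B r c := by
  unfold leMatD at h
  have := (allN_eq_true.1 ((allN_eq_true.1 h) r hr)) c hc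
  exact (Dyad.ble_iff _ _).1 this

/-- `dre (magM n M) r c` is the magnitude of the entry. [folklore] -/
theorem dre_magM {n : ℕ} (M : Array (Array IntervalD)) {r c : ℕ} (hr : r < n) (hc : c < n) :
    dre (magM n M) r c = (IntervalD.mag (imget M r c)).toReal := by
  simp only [magM, dre, dmget_ofFn_row _ c hr, dget_ofFn _ hc]
  rfl

/-- The identity interval matrix contains the identity. [folklore] -/
theorem memMat_idIM (n : ℕ) : MemMat n (fun r c => if r = c then (1:ℝ) else 0) (idIM n) := by
  intro r hr c hc
  simp only [idIM, imget_ofFn_row _ c hr, IntervalD.aget_ofFn _ hc]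
  split_ifs with h
  · have := IntervalD.mem_ofInt 1; simpa using this
  · have := IntervalD.mem_ofInt 0; simpa using this

/-- `Array.getD` below the size after a `push`. [folklore] -/
theorem getD_push_lt {α : Type} (a : Array α) (x d : α) {i : ℕ} (h : i < a.size) : (a.push x).getD i d = a.getD i d := by
  simp [Array.getD, h, Nat.lt_succ_of_lt h, Array.getElem_push_lt]

/-- `Array.getD` at the old size after a `push`. [folklore] -/
theorem getD_push_size {α : Type} (a : Array α) (x d : α) : (a.push x).getD a.size d = x := by
  simp [Array.getD]

/-- `Array.getD` of a `map`. [folklore] -/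
theorem getD_map_of_lt {α β : Type} (f : α → β) (a : Array α) {i : ℕ} (h : i < a.size) (d : β) (d' : α) :
    (a.map f).getD i d = f (a.getD i d') := by
  simp [Array.getD, h]

/-- `Array.getD` of `Array.ofFn`. [folklore] -/
theorem getD_ofFn_lt {α : Type} {n : ℕ} (f : Fin n → α) {i : ℕ} (h : i < n) (d : α) :
    (Array.ofFn f).getD i d = f ⟨i, h⟩ := by
  simp [Array.getD, h]

namespace CertTablesV

variable {TV : CertTablesV} {kitOf : ℕ → CoreKit} {wT : ℕ → Array Dyad} {sc : ScalarsV}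

/-! ### Field reductions -/

/-- [folklore] -/ theorem cd_L1 (j s : ℕ) : (TV.toCertDataVW kitOf wT sc).L1 j s = ((TV.coreVW kitOf wT j s).L1).toReal := rfl
/-- [folklore] -/ theorem cd_LamV (j : ℕ) : (TV.toCertDataVW kitOf wT sc).Λ j = QS2.toRealHom (TV.base.stage j).Λ := rfl
/-- [folklore] -/ theorem cd_SV (j : ℕ) : (TV.toCertDataVW kitOf wT sc).S j = TV.S j := rfl
/-- [folklore] -/ theorem gctx_n (j L q : ℕ) : (TV.gctx j L q).n = TV.base.n := rfl
/-- [folklore] -/ theorem gctx_prec (j L q : ℕ) : (TV.gctx j L q).prec = TV.prec := rfl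
/-- [folklore] -/ theorem gctx_ωinvhi (j L q : ℕ) : (TV.gctx j L q).ωinvhi = TV.ωinvhiV j := rfl
/-- [folklore] -/ theorem gctx_ωhi (j L q : ℕ) : (TV.gctx j L q).ωhi = TV.ωhiV j := rfl
/-- [folklore] -/ theorem gctx_q (j L q : ℕ) : (TV.gctx j L q).q = q := rfl
/-- [folklore] -/ theorem gctx_L (j L q : ℕ) : (TV.gctx j L q).L = L := rfl
/-- [folklore] -/ theorem gctx_gL1 (j L q : ℕ) : (TV.gctx j L q).gL1 = TV.gL1 j := rfl
/-- [folklore] -/ theorem gctx_S (j L q : ℕ) : (TV.gctx j L q).S = TV.S j := rfl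
/-- `facOf` does not depend on the chunk index. [folklore] -/
theorem facOf_gctx (j L q q' : ℕ) (P : Array (Array IntervalD)) (w : Array Dyad) :
    (TV.gctx j L q).facOf P w = (TV.gctx j L q').facOf P w := rfl

/-! ### Weights -/

/-- `ω_j(wk c) ≤ ω↑_c`. [folklore] -/
theorem omega_le_ωhi (j : ℕ) {c : ℕ} (hc : c < TV.base.n) :
    (TV.toCertDataVW kitOf wT sc).ω j (TV.base.wk c) ≤ vre (TV.ωhiV j) c := by
  have hk := TV.base.InW_wk hc
  have h := (mem_ωB (TV := TV) (kitOf := kitOf) (wT := wT) (sc := sc) j (TV.base.wi c) (TV.base.wk c) hk.1 hk.2).2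
  rw [TV.base.idx_wi_wk hc] at h
  unfold ωhiV vre
  rw [dget_ofFn _ hc]
  exact h

/-- `ω_j(wk c)⁻¹ ≤ (ω⁻¹)↑_c`. [folklore] -/
theorem omegaInv_le_ωinvhi (j : ℕ) {c : ℕ} (hc : c < TV.base.n) :
    ((TV.toCertDataVW kitOf wT sc).ω j (TV.base.wk c))⁻¹ ≤ vre (TV.ωinvhiV j) c := by
  have hk := TV.base.InW_wk hc
  have h := (mem_ωinvB (TV := TV) (kitOf := kitOf) (wT := wT) (sc := sc) j (TV.base.wi c) (TV.base.wk c) hk.1 hk.2).2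
  rw [TV.base.idx_wi_wk hc] at h
  unfold ωinvhiV vre
  rw [dget_ofFn _ hc]
  exact h

end CertTablesV

/-! ### `facOf` bounds the weighted row sums (abstract context) -/

namespace GCtx

/-- **`facOf` spec**: with weights `ω > 0` whose inverses are below `ωinvhi`, every row sum `Σ_t mag(P_{r,t})·w_t` is at most
`facOf P w · ω_r`. [folklore] -/
theorem rowsum_le_facOf (G : GCtx) (ω : ℕ → ℝ) (hωpos : ∀ r < G.n, 0 < ω r) (hinv : ∀ r < G.n, (ω r)⁻¹ ≤ vre G.ωinvhi r)
    (P : Array (Array IntervalD)) (w : Array Dyad) {r : ℕ} (hr : r < G.n) :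
    ∑ t ∈ Finset.range G.n, (IntervalD.mag (imget P r t)).toReal * vre w t ≤ (G.facOf P w).toReal * ω r := by
  have hωr := hωpos r hr
  -- the row sum is below the rounded row
  have h1 : ∑ t ∈ Finset.range G.n, (IntervalD.mag (imget P r t)).toReal * vre w t ≤
      vre (absMulVecUp G.n G.prec (magM G.n P) w) r :=
    sum_le_absMulVecUp G.prec (fun r hr t ht => by rw [dre_magM P hr ht]) hr
  -- `row · ωinvhi ≤ facOf`
  have h2 : vre (absMulVecUp G.n G.prec (magM G.n P) w) r * vre G.ωinvhi r ≤ (G.facOf P w).toReal := by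
    have := le_maxUpTo (fun r => Dyad.mulUp G.prec (dget (absMulVecUp G.n G.prec (magM G.n P) w) r) (dget G.ωinvhi r)) hr
    exact le_trans (Dyad.mul_le_mulUp G.prec _ _) this
  by_cases hS : ∑ t ∈ Finset.range G.n, (IntervalD.mag (imget P r t)).toReal * vre w t ≤ 0
  · exact hS.trans (mul_nonneg (maxUpTo_nonneg _ _) hωr.le)
  · push Not at hS
    have hrowpos : 0 < vre (absMulVecUp G.n G.prec (magM G.n P) w) r := hS.trans_le h1
    have h3 : vre (absMulVecUp G.n G.prec (magM G.n P) w) r * (ω r)⁻¹ ≤ (G.facOf P w).toReal :=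
      (mul_le_mul_of_nonneg_left (hinv r hr) hrowpos.le).trans h2
    rw [mul_inv_le_iff₀ hωr] at h3
    exact h1.trans h3

/-- `0 ≤ facOf`. [folklore] -/
theorem facOf_nonneg (G : GCtx) (P : Array (Array IntervalD)) (w : Array Dyad) : 0 ≤ (G.facOf P w).toReal :=
  maxUpTo_nonneg _ _

end GCtx

namespace CertTablesV

variable {TV : CertTablesV} {kitOf : ℕ → CoreKit} {wT : ℕ → Array Dyad} {sc : ScalarsV}

/-- **`facOf` spec for the stage context**: `Σ_t mag(P_{r,t})·w_t ≤ facOf P w · ω_j(wk r)` (weights positive). [folklore] -/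
theorem rowsum_le_facOf (j L q : ℕ) (hω : ∀ k, 0 < (TV.toCertDataVW kitOf wT sc).ω j k) (P : Array (Array IntervalD))
    (w : Array Dyad) {r : ℕ} (hr : r < TV.base.n) :
    ∑ t ∈ Finset.range TV.base.n, (IntervalD.mag (imget P r t)).toReal * vre w t ≤
      ((TV.gctx j L q).facOf P w).toReal * (TV.toCertDataVW kitOf wT sc).ω j (TV.base.wk r) :=
  (TV.gctx j L q).rowsum_le_facOf (fun r => (TV.toCertDataVW kitOf wT sc).ω j (TV.base.wk r)) (fun _ _ => hω _)
    (fun _ hr => omegaInv_le_ωinvhi (sc := sc) j hr) P w hr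

/-! ### The growth step: Boolean unpacking and the product invariant -/

/-- The products returned by the step. [folklore] -/
theorem step_fst (G : GCtx) (s : ℕ) (M : Array (Array IntervalD)) (coL1 : Dyad) (pre : Array (Array (Array IntervalD))) :
    (G.step s M coL1 pre).1 = (pre.map fun P => mulII G.n G.prec M P).push M := rfl

/-- The Boolean of the step, unpacked. [folklore] -/
theorem step_snd_iff (G : GCtx) (s : ℕ) (M : Array (Array IntervalD)) (coL1 : Dyad) (pre : Array (Array (Array IntervalD))) :
    (G.step s M coL1 pre).2 = true ↔
      (Dyad.ble Dyad.zero coL1 = true ∧ Dyad.ble coL1 (dget G.gL1 s) = true) ∧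
      (∀ i < ((pre.map fun P => mulII G.n G.prec M P).push M).size,
        G.pairTest (G.q * G.L + i) (s + 1)
          (G.facOf (((pre.map fun P => mulII G.n G.prec M P).push M).getD i #[]) G.ωhi) = true) ∧
      G.pairTest (s + 1) (s + 1) (G.facOf (idIM G.n) G.ωhi) = true ∧
      (∀ a' < G.q * G.L, G.pairTest a' (s + 1)
        (G.facOf (((pre.map fun P => mulII G.n G.prec M P).push M).getD 0 #[]) (G.W.getD a' #[])) = true) := by
  simp only [GCtx.step, Bool.and_eq_true, allN_eq_true, and_assoc]

/-- **The product invariant is preserved**: if `pre[i] = prodM (qL+i) (s − (qL+i))` for `i < s − qL`, then after the step at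
sub-step `s` (kernel box `M_s`), `pre'[i] = prodM (qL+i) (s+1 − (qL+i))` for `i < s + 1 − qL`. [folklore] -/
theorem pre_invariant (j q L s : ℕ) (hs : q * L ≤ s) (pre : Array (Array (Array IntervalD))) (hsz : pre.size = s - q * L)
    (hpre : ∀ i < pre.size, pre.getD i #[] = TV.prodM kitOf wT j (q * L + i) (s - (q * L + i))) :
    ((pre.map fun P => mulII TV.base.n TV.prec (TV.Mk kitOf wT j s) P).push (TV.Mk kitOf wT j s)).size = s + 1 - q * L ∧
    ∀ i < ((pre.map fun P => mulII TV.base.n TV.prec (TV.Mk kitOf wT j s) P).push (TV.Mk kitOf wT j s)).size,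
      ((pre.map fun P => mulII TV.base.n TV.prec (TV.Mk kitOf wT j s) P).push (TV.Mk kitOf wT j s)).getD i #[] =
        TV.prodM kitOf wT j (q * L + i) (s + 1 - (q * L + i)) := by
  have hsize : ((pre.map fun P => mulII TV.base.n TV.prec (TV.Mk kitOf wT j s) P).push (TV.Mk kitOf wT j s)).size = s + 1 - q * L := by
    simp only [Array.size_push, Array.size_map, hsz]; omega
  refine ⟨hsize, fun i hi => ?_⟩
  rw [hsize] at hi
  by_cases hlt : i < pre.size
  · -- an extended product
    have hmap : i < (pre.map fun P => mulII TV.base.n TV.prec (TV.Mk kitOf wT j s) P).size := by simpa using hlt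
    rw [getD_push_lt _ _ _ hmap, getD_map_of_lt _ _ hlt _ #[], hpre i hlt]
    obtain ⟨m, hm⟩ : ∃ m, s - (q * L + i) = m + 1 := ⟨s - (q * L + i) - 1, by omega⟩
    have e2 : s + 1 - (q * L + i) = m + 2 := by omega
    rw [hm, e2]
    show _ = mulII TV.base.n TV.prec (TV.Mk kitOf wT j (q * L + i + m + 1)) (TV.prodM kitOf wT j (q * L + i) (m + 1))
    have e3 : q * L + i + m + 1 = s := by omega
    rw [e3]
  · -- the fresh kernel box
    have hi' : i = pre.size := by omega
    subst hi'
    have e : (pre.map fun P => mulII TV.base.n TV.prec (TV.Mk kitOf wT j s) P).size = pre.size := by simp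
    have hg : ((pre.map fun P => mulII TV.base.n TV.prec (TV.Mk kitOf wT j s) P).push (TV.Mk kitOf wT j s)).getD pre.size #[] =
        TV.Mk kitOf wT j s := by
      have := getD_push_size (pre.map fun P => mulII TV.base.n TV.prec (TV.Mk kitOf wT j s) P) (TV.Mk kitOf wT j s) #[]
      rwa [e] at this
    have e2 : s + 1 - (q * L + pre.size) = 1 := by omega
    rw [hg, e2]
    show _ = TV.Mk kitOf wT j (q * L + pre.size)
    have e3 : q * L + pre.size = s := by omega
    rw [e3]

/-! ### Soundness of the chunk run -/

/-- **`growthRun` from the true node state certifies every sub-step it runs** — chain Boolean, predicate, `0 ≤ L1_s ≤ gL1[s]`, and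
the pair tests of all pairs `(a', s+1)` with the factors of the TRUE products `prodM` — and the claims at the end. [folklore] -/
theorem growthRun_sound (P : ℕ → CoreOut → Bool) (j L q : ℕ) :
    ∀ (k s : ℕ) (pre : Array (Array (Array IntervalD))),
      TV.growthRun kitOf wT P j (TV.gctx j L q) k s ((TV.ctxOfW kitOf wT j).nodeAt s) pre = true →
      q * L ≤ s → pre.size = s - q * L →
      (∀ i < pre.size, pre.getD i #[] = TV.prodM kitOf wT j (q * L + i) (s - (q * L + i))) →
      (∀ i, i < k →
        ((TV.ctxOfW kitOf wT j).subStep (s + i) ((TV.ctxOfW kitOf wT j).nodeAt (s + i))).ok = true ∧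
        P (s + i) ((TV.ctxOfW kitOf wT j).subStep (s + i) ((TV.ctxOfW kitOf wT j).nodeAt (s + i))).core = true ∧
        (Dyad.ble Dyad.zero (TV.coreVW kitOf wT j (s + i)).L1 = true ∧
          Dyad.ble (TV.coreVW kitOf wT j (s + i)).L1 (dget (TV.gL1 j) (s + i)) = true) ∧
        (∀ i', i' < s + i + 1 - q * L → (TV.gctx j L q).pairTest (q * L + i') (s + i + 1)
          ((TV.gctx j L q).facOf (TV.prodM kitOf wT j (q * L + i') (s + i + 1 - (q * L + i'))) (TV.ωhiV j)) = true) ∧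
        (TV.gctx j L q).pairTest (s + i + 1) (s + i + 1) ((TV.gctx j L q).facOf (idIM TV.base.n) (TV.ωhiV j)) = true ∧
        (∀ a' < q * L, (TV.gctx j L q).pairTest a' (s + i + 1)
          ((TV.gctx j L q).facOf (TV.prodM kitOf wT j (q * L) (s + i + 1 - q * L))
            ((TV.gctx j L q).W.getD a' #[])) = true)) ∧
      ∃ preF : Array (Array (Array IntervalD)), preF.size = s + k - q * L ∧
        (∀ i < preF.size, preF.getD i #[] = TV.prodM kitOf wT j (q * L + i) (s + k - (q * L + i))) ∧
        (TV.gctx j L q).claimsOK (s + k) preF = true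
  | 0, s, pre, h, hs, hsz, hpre => by
    refine ⟨fun i hi => absurd hi (Nat.not_lt_zero i), pre, by simpa using hsz, ?_, ?_⟩
    · simpa using hpre
    · simpa [growthRun] using h
  | k + 1, s, pre, h, hs, hsz, hpre => by
    simp only [growthRun, Bool.and_eq_true] at h
    obtain ⟨⟨⟨hok, hP⟩, hstep⟩, hrest⟩ := h
    -- identify the run's objects with the true ones
    have hnext : ((TV.ctxOfW kitOf wT j).subStep s ((TV.ctxOfW kitOf wT j).nodeAt s)).next =
        (TV.ctxOfW kitOf wT j).nodeAt (s + 1) := rfl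
    have hM : ((TV.ctxOfW kitOf wT j).subStep s ((TV.ctxOfW kitOf wT j).nodeAt s)).core.M = TV.Mk kitOf wT j s := rfl
    have hL : ((TV.ctxOfW kitOf wT j).subStep s ((TV.ctxOfW kitOf wT j).nodeAt s)).core.L1 = (TV.coreVW kitOf wT j s).L1 := rfl
    rw [hnext, step_fst, hM] at hrest
    rw [step_snd_iff, hM, hL] at hstep
    simp only [gctx_n, gctx_prec, gctx_q, gctx_L, gctx_gL1, gctx_ωhi] at hrest hstep
    obtain ⟨hL1, hIn, hDiag, hOut⟩ := hstep
    obtain ⟨hsz', hpre'⟩ := pre_invariant (TV := TV) (kitOf := kitOf) (wT := wT) j q L s hs pre hsz hpre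
    have ih := growthRun_sound P j L q k (s + 1) _ hrest (by omega) hsz' hpre'
    refine ⟨fun i hi => ?_, ?_⟩
    · cases i with
      | zero =>
        simp only [Nat.add_zero]
        refine ⟨hok, hP, hL1, fun i' hi' => ?_, ?_, fun a' ha' => ?_⟩
        · have hi'' : i' < ((pre.map fun P => mulII TV.base.n TV.prec (TV.Mk kitOf wT j s) P).push (TV.Mk kitOf wT j s)).size := by
            rw [hsz']; exact hi'
          have := hIn i' hi''
          rw [hpre' i' hi''] at this
          exact this
        · exact hDiag
        · have h0 : 0 < ((pre.map fun P => mulII TV.base.n TV.prec (TV.Mk kitOf wT j s) P).push (TV.Mk kitOf wT j s)).size := by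
            rw [hsz']; omega
          have := hOut a' ha'
          rw [hpre' 0 h0] at this
          simpa using this
      | succ i =>
        have := ih.1 i (Nat.lt_of_succ_lt_succ hi)
        simpa only [Nat.add_succ, Nat.succ_add, Nat.add_assoc] using this
    · obtain ⟨preF, h1, h2, h3⟩ := ih.2
      refine ⟨preF, by omega, fun i hi => ?_, ?_⟩
      · rw [h2 i hi]; congr 1; omega
      · have e : s + 1 + k = s + (k + 1) := by omega
        rw [e] at h3; exact h3


/-- **Soundness of the growth chunk check** (from the chunk's start state): the conclusions of `growthRun_sound` for the chunk
`[qL, qL + min L (S − qL))` with the TRUE products from `pre = #[]`. [folklore] -/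
theorem growthRange_sound {P : ℕ → CoreOut → Bool} {j L q : ℕ} (h : TV.growthRange kitOf wT P j L q = true) :
    (∀ i, i < min L (TV.S j - q * L) →
        ((TV.ctxOfW kitOf wT j).subStep (q * L + i) ((TV.ctxOfW kitOf wT j).nodeAt (q * L + i))).ok = true ∧
        P (q * L + i) ((TV.ctxOfW kitOf wT j).subStep (q * L + i) ((TV.ctxOfW kitOf wT j).nodeAt (q * L + i))).core = true ∧
        (Dyad.ble Dyad.zero (TV.coreVW kitOf wT j (q * L + i)).L1 = true ∧
          Dyad.ble (TV.coreVW kitOf wT j (q * L + i)).L1 (dget (TV.gL1 j) (q * L + i)) = true) ∧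
        (∀ i', i' < q * L + i + 1 - q * L → (TV.gctx j L q).pairTest (q * L + i') (q * L + i + 1)
          ((TV.gctx j L q).facOf (TV.prodM kitOf wT j (q * L + i') (q * L + i + 1 - (q * L + i'))) (TV.ωhiV j)) = true) ∧
        (TV.gctx j L q).pairTest (q * L + i + 1) (q * L + i + 1) ((TV.gctx j L q).facOf (idIM TV.base.n) (TV.ωhiV j)) = true ∧
        (∀ a' < q * L, (TV.gctx j L q).pairTest a' (q * L + i + 1)
          ((TV.gctx j L q).facOf (TV.prodM kitOf wT j (q * L) (q * L + i + 1 - q * L))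
            ((TV.gctx j L q).W.getD a' #[])) = true)) ∧
      ∃ preF : Array (Array (Array IntervalD)), preF.size = q * L + min L (TV.S j - q * L) - q * L ∧
        (∀ i < preF.size, preF.getD i #[] = TV.prodM kitOf wT j (q * L + i) (q * L + min L (TV.S j - q * L) - (q * L + i))) ∧
        (TV.gctx j L q).claimsOK (q * L + min L (TV.S j - q * L)) preF = true := by
  unfold growthRange at h
  rw [StageCtx.startNode_eq_nodeAt] at h
  exact growthRun_sound P j L q _ _ #[] h le_rfl (by simp) (by simp)

/-- **The claims, unpacked**: if a later chunk exists (`(q+1)L < S`), the chunk run certified `|prodM (qL) L| ≤ T̃_q` entrywise and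
`(|prodM a ((q+1)L − a)|·ω↑)↑ ≤ ũ_a` coordinatewise for every start `a` of chunk `q`. [folklore] -/
theorem claims_sound {P : ℕ → CoreOut → Bool} {j L q : ℕ} (h : TV.growthRange kitOf wT P j L q = true) (hL : 0 < L)
    (hlater : (q + 1) * L < TV.S j) :
    (∀ r < TV.base.n, ∀ c < TV.base.n,
        dre (magM TV.base.n (TV.prodM kitOf wT j (q * L) L)) r c ≤ dre (TV.gT j q) r c) ∧
    (∀ a, q * L ≤ a → a < (q + 1) * L → ∀ c < TV.base.n,
        vre (absMulVecUp TV.base.n TV.prec (magM TV.base.n (TV.prodM kitOf wT j a ((q + 1) * L - a))) (TV.ωhiV j)) c ≤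
          vre (TV.gU j a) c) := by
  obtain ⟨-, preF, hsz, hpre, hcl⟩ := growthRange_sound (TV := TV) (kitOf := kitOf) (wT := wT) h
  have hend : (q + 1) * L = q * L + L := by ring
  have hmin : min L (TV.S j - q * L) = L := min_eq_left (by omega)
  rw [hmin] at hsz hpre hcl
  unfold GCtx.claimsOK at hcl
  simp only [gctx_S, gctx_n, gctx_prec, gctx_q, gctx_L, gctx_ωhi, Bool.or_eq_true, decide_eq_true_eq, Bool.and_eq_true,
    allN_eq_true] at hcl
  rcases hcl with hle | ⟨hT, hU⟩
  · exfalso; omega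
  have hszL : preF.size = L := by rw [hsz]; omega
  constructor
  · intro r hr c hc
    have h0 : 0 < preF.size := by rw [hszL]; exact hL
    have e0 := hpre 0 h0
    simp only [Nat.add_zero] at e0
    have e1 : q * L + L - q * L = L := by omega
    rw [e1] at e0
    have := le_of_leMatD hT hr hc
    rw [e0] at this
    exact this
  · intro a ha1 ha2 c hc
    have hi : a - q * L < preF.size := by rw [hszL]; omega
    have e0 := hpre (a - q * L) hi
    have e1 : q * L + (a - q * L) = a := by omega
    rw [e1] at e0
    have e2 : q * L + L - a = (q + 1) * L - a := by omega
    rw [e2] at e0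
    have := le_of_leVec (hU (a - q * L) hi) hc
    rw [e0, e1] at this
    exact this


end CertTablesV

end Summit.NavierStokesRegularity.NavierStokesRegularity.Theorems.TaylorModelCert
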